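import Summits.FinalStateConjecture.FinalStateConjecture.Theses.KerrnessPropagates
import Summits.FinalStateConjecture.FinalStateConjecture.Theorems.KerrnessPropagatesKerrBasinCaptureStubSlabTransferAtTime
import Summits.FinalStateConjecture.FinalStateConjecture.Theorems.KerrnessPropagatesKerrBasinCaptureStubReanchorMapShear
import Summits.FinalStateConjecture.FinalStateConjecture.Theorems.KerrnessPropagatesKerrBasinCaptureStubUniformBoostedKerrDecay
import Summits.FinalStateConjecture.FinalStateConjecture.Theorems.KerrnessPropagatesKerrBasinCaptureStubFarFieldFlatness
import Summits.FinalStateConjecture.FinalStateConjecture.Theorems.KerrnessPropagatesKerrBasinCaptureStubFlatPathExists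
import Summits.FinalStateConjecture.FinalStateConjecture.Theorems.KerrnessPropagatesKerrBasinCaptureStubDirectionDodging
import Summits.FinalStateConjecture.FinalStateConjecture.Theorems.KerrnessPropagatesKerrBasinCaptureStubKerrFamilyContinuity
import Literature.Geometry.Lorentzian.KerrRadiusSpinLipschitz
import Literature.Geometry.Lorentzian.KerrSurfaceGravity

/-!
# Route `KerrnessPropagates`, crux `KerrBasinCapture` (stmt-FinalStateConjecture-17646), line `registered`
# (skeleton `Cruxes/KerrBasinCapture/Lines/birth.lean`, lead rev 7) — stub `stub_slabTransferCore3`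

**Slab transfer to the limit configuration — the sequential assembly.** For a sequence of
multi-Kerr configurations `cfg n = (M n, a n, r₀ n, mo n)` in the margins `(N₀, m₀, χ, μ, v₀, L₀)`
converging to a limit configuration `cfgₗ = (Mₗ, aₗ, rₗ, moₗ)` (masses, spins, inner radii,
frames `Λ → Λₗ` and `Λ⁻¹ → Λₗ⁻¹` in operator norm), hand-over slabs of small accuracy `ε ≤ ε₀` for
`cfg n`, `n ≥ n₀`, at late lab times `τ ≥ T(n)` are transferred to hand-over slabs of any prescribed
accuracy `ε'` for the limit configuration with inner radii `rₗ + μ/2`.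

The registered antecedents enter as hypotheses (all landed theorems of this namespace):
A′ = `stub_reanchorMapShear`, P = `stub_transferChart`, G = `stub_uniformBoostedKerrDecay`,
B = `stub_farFieldFlatness` (conditional on G), C1 = `stub_flatPathExists`,
C2 = `stub_orientationTransport`, A = `stub_reanchorMapExists` (superseded by A′),
T2a = `stub_largeNearZones`, T2b = `stub_directionDodging`, T2c = `stub_kerrFamilyContinuity`.

Proof. STEP 0 (constants from `ε'`): the jet constants `A_k = 4ᵏ k! 2^{k+2}`,
`B_k = 2^{k+2} ‖η‖`; `(C_B, ρ_B)` from B; `R̄ = 2m₀⁻¹ + ρ_B + 3 + max(C_B,0)(16 + 4A_k/ε')`;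
`η = min(1/8, ε'/(4(B_k+1)))`; `δ_A` from A′ at `(k, N, 1 + 3 max(L₀,0), η)`; `ε₀` from T2a at
`R̄ + 3`, capped by `1/16` and `ε'/(4A_k)`. STEP 1 (`n₀`): finitely many eventualities —
`‖Λₙⱼ − Λₗⱼ‖ ≤ δ_A`, `|aₙⱼ² − aₗⱼ²| ≤ μ min(μ/8,1)`, `|r₀ₙⱼ − rₗⱼ| ≤ μ/4`, lab velocities
`δ'v₀/64`-close, and T2c applied to the EXPLICIT shear frames
`TFⱼ(n) = (id + κₙⱼ⁻¹(dx⁰∘Λₗⱼ − dx⁰∘Λₙⱼ) ⊗ ∂₀) ∘ Λₗⱼ⁻¹ → Λₗⱼ⁻¹` (norm squeeze) with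
`TFⱼ(n)(Λₗⱼ∂₀) ∈ ℝ∂₀`. STEP 2 (`T`, for fixed `n ≥ n₀`): T2a's and C1's late times, and recession:
with `ϱ = v₀τ/32` the limit holes are `16ϱ`-separated (`sub_le_norm_centre_sub`) and the two
configurations' lab positions `δ'ϱ`-close. STEP 3–4: the radius bookkeeping, the transferred chart,
the near/far jet estimates and the orientation transport are `slabTransferAtTime_expanded`
(`Theorems/KerrnessPropagatesKerrBasinCaptureStubSlabTransferAtTime.lean`), fed with A′'s map `Θ`,
T2a's wide near zones, B's far flatness, C1's flat paths and T2c's family continuity; the spin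
mismatch of the Kerr–Schild radius is `Kerr.abs_radius_sub_radius_le_div_of_le`
(`Literature/Geometry/Lorentzian/KerrRadiusSpinLipschitz.lean`). [folklore]
-/

open scoped BigOperators Topology Manifold Classical Matrix InnerProductSpace ContinuousMap
open Filter Set Function TopologicalSpace
open Literature.Geometry.Lorentzian

-- D-0017: single-problem summit, `Summit.<S>.<S>.…` by design.
set_option linter.dupNamespace false

namespace Summit.FinalStateConjecture.FinalStateConjecture.Theorems.KerrnessPropagates.KerrBasinCapture

open Summit.FinalStateConjecture.FinalStateConjecture.Theorems

/-! ### The stub -/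

-- the ten registered antecedents make a ~20 kB statement; every tactic step pays for the huge
-- local context, so the default heartbeat budget of one command does not suffice
set_option maxHeartbeats 1600000 in
/-- stub_slabTransferCore3 — **SLAB TRANSFER TO THE LIMIT CONFIGURATION** (registered stub of crux
stmt-FinalStateConjecture-17646, line `registered`; the final assembly of the line's pointwise leg).
Given the registered antecedents A′ (re-anchoring map with explicit shear frames), P (transferred
chart), G (uniform boosted Kerr–Schild decay), B|G (far-field flatness), C1 (flat paths), C2
(orientation transport), A, T2a (wide near zones), T2b, T2c (continuity of the re-anchored
Kerr–Schild family): for margins-bounded configurations `cfg n → cfgₗ` and every `ε' > 0` there are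
`n₀`, `ε₀ > 0` and, for `n ≥ n₀`, a late time `T` such that every hand-over slab of accuracy
`ε ≤ ε₀` for `cfg n` at lab time `τ ≥ T` yields one of accuracy `ε'` for the limit configuration
(inner radii `rₗ + μ/2`). STEP 0 fixes `R̄, η, δ_A, ε₀` from `ε'`; STEP 1 extracts `n₀` from the
finitely many eventualities (frames, spins, inner radii, lab velocities, and T2c applied to the
explicit shear frames `TFⱼ(n) → Λₗⱼ⁻¹`); STEP 2 fixes `T` (T2a, C1, recession separating the limit
holes `16ϱ` with `ϱ = v₀τ/32`, offsets `≤ δ_A ϱ`); STEP 3–4 are `slabTransferAtTime_expanded`.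
[folklore] -/
theorem slabTransferCore3_expanded : (∀ (k N : ℕ) (L₀ η : ℝ), 1 ≤ L₀ → 0 < η → ∃ δ : ℝ, 0 < δ ∧ ∀ (Λn Λl : Fin N → ↥lorentzGroup) (cn cl : Fin N → E4) (τ ϱ : ℝ), 1 ≤ ϱ → (∀ j, ‖(((Λl j : ↥lorentzGroup) : E4 ≃L[ℝ] E4) : E4 →L[ℝ] E4)‖ ≤ L₀ ∧ ‖((((Λl j : ↥lorentzGroup) : E4 ≃L[ℝ] E4)).symm : E4 →L[ℝ] E4)‖ ≤ L₀ ∧ ‖(((Λn j : ↥lorentzGroup) : E4 ≃L[ℝ] E4) : E4 →L[ℝ] E4)‖ ≤ L₀ ∧ ‖(((Λn j : ↥lorentzGroup) : E4 ≃L[ℝ] E4) : E4 →L[ℝ] E4) - (((Λl j : ↥lorentzGroup) : E4 ≃L[ℝ] E4) : E4 →L[ℝ] E4)‖ ≤ δ) → (∀ j, ‖(E4.spatial (cn j) + ((τ) - (cn j) 0) • (((((Λn j : ↥lorentzGroup) : E4 ≃L[ℝ] E4)) (E4.basisVector 0) 0)⁻¹ • E4.spatial ((((Λn j : ↥lorentzGroup)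 : E4 ≃L[ℝ] E4)) (E4.basisVector 0)))) - (E4.spatial (cl j) + ((τ) - (cl j) 0) • (((((Λl j : ↥lorentzGroup) : E4 ≃L[ℝ] E4)) (E4.basisVector 0) 0)⁻¹ • E4.spatial ((((Λl j : ↥lorentzGroup) : E4 ≃L[ℝ] E4)) (E4.basisVector 0))))‖ ≤ δ * ϱ) → (∀ i j, i ≠ j → 16 * ϱ ≤ ‖(E4.spatial (cl i) + ((τ) - (cl i) 0) • (((((Λl i : ↥lorentzGroup) : E4 ≃L[ℝ] E4)) (E4.basisVector 0) 0)⁻¹ • E4.spatial ((((Λl i : ↥lorentzGroup) : E4 ≃L[ℝ] E4)) (E4.basisVector 0)))) - (E4.spatial (cl j) + ((τ) - (cl j) 0) • (((((Λl j : ↥lorentzGroup) : E4 ≃L[ℝ] E4)) (E4.basisVector 0) 0)⁻¹ • E4.spatial ((((Λl j : ↥lorentzGroup) : E4 ≃L[ℝ] E4)) (E4.basisVector 0))))‖) → ∃ (Θ : E4 → E4) (β : Fin N → ℝ), ContDiff ℝ (⊤ : ℕ∞) Θ ∧ (∀ x, (Θ x) 0 = x 0) ∧ (∀ x : E4, |x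 0 - τ| < 1 → ‖fderiv ℝ Θ x - ContinuousLinearMap.id ℝ E4‖ ≤ η ∧ ‖Θ x - x‖ ≤ η * ϱ ∧ ∀ m : ℕ, 2 ≤ m → m ≤ k + 1 → ‖iteratedFDeriv ℝ m Θ x‖ ≤ η) ∧ Topology.IsOpenEmbedding ({x : E4 | |x 0 - τ| < 1}.restrict Θ) ∧ (∀ j, ∀ x : E4, |x 0 - τ| < 1 → ‖E4.spatial x - (E4.spatial (cl j) + ((τ) - (cl j) 0) • (((((Λl j : ↥lorentzGroup) : E4 ≃L[ℝ] E4)) (E4.basisVector 0) 0)⁻¹ • E4.spatial ((((Λl j : ↥lorentzGroup) : E4 ≃L[ℝ] E4)) (E4.basisVector 0))))‖ ≤ ϱ → fderiv ℝ Θ x = (((Λn j : ↥lorentzGroup) : E4 ≃L[ℝ] E4) : E4 →L[ℝ] E4).comp ((ContinuousLinearMap.id ℝ E4 + (((((Λn j : ↥lorentzGroup) : E4 ≃L[ℝ] E4) (E4.basisVector 0)) 0)⁻¹ • ((E4.dx 0).comp (((Λl j : ↥lorentzGroup) : E4 ≃L[ℝ] E4) : E4 →L[ℝ] E4) - (E4.dx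 0).comp (((Λn j : ↥lorentzGroup) : E4 ≃L[ℝ] E4) : E4 →L[ℝ] E4))).smulRight (E4.basisVector 0)).comp ((((Λl j : ↥lorentzGroup) : E4 ≃L[ℝ] E4)).symm : E4 →L[ℝ] E4)) ∧ poincareInv (Λn j) (cn j) (Θ x) = ((ContinuousLinearMap.id ℝ E4 + (((((Λn j : ↥lorentzGroup) : E4 ≃L[ℝ] E4) (E4.basisVector 0)) 0)⁻¹ • ((E4.dx 0).comp (((Λl j : ↥lorentzGroup) : E4 ≃L[ℝ] E4) : E4 →L[ℝ] E4) - (E4.dx 0).comp (((Λn j : ↥lorentzGroup) : E4 ≃L[ℝ] E4) : E4 →L[ℝ] E4))).smulRight (E4.basisVector 0)).comp ((((Λl j : ↥lorentzGroup) : E4 ≃L[ℝ] E4)).symm : E4 →L[ℝ] E4)) (x - cl j) + β j • E4.basisVector 0)) → (∀ k : ℕ, ∀ (X : Type) [TopologicalSpace X] [ChartedSpace E3 X] [IsManifold (𝓡 3) (⊤ : ℕ∞) X] [T2Space X] [SecondCountableTopology X] [ConnectedSpace X] (D : InitialDataSet (𝓡 3) X) (𝒟 : VacuumCauchyDevelopment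 D) (N : ℕ) (aₙ r₀ₙ : Fin N → ℝ) (moₙ : Fin N → ↥lorentzGroup × E4) (aₗ r₀ₗ : Fin N → ℝ) (moₗ : Fin N → ↥lorentzGroup × E4) (τ : ℝ) (U : Opens E4) (Φ : U → 𝒟.carrier) (Θ : E4 → E4), ContMDiff 𝓘(ℝ, E4) (𝓡 4) (⊤ : ℕ∞) Φ → Topology.IsOpenEmbedding Φ → {x : E4 | x 0 = τ ∧ ∀ j, r₀ₙ j < Kerr.radius (aₙ j) (poincareInv (moₙ j).1 (moₙ j).2 x)} ⊆ (U : Set E4) → range Φ ⊆ 𝒟.metric.causalFuture 𝒟.timeOrientation (range 𝒟.embed) → 𝒟.metric.IsAchronal 𝒟.timeOrientation (Φ '' {x : ↥U | (x : E4) 0 = τ}) → ContDiff ℝ (⊤ : ℕ∞) Θ → (∀ x, (Θ x) 0 = x 0) → Topology.IsOpenEmbedding ({x : E4 | |x 0 - τ| < 1}.restrict Θ) → (∀ x : E4, x 0 = τ → (∀ j, r₀ₗ j < Kerr.radius (aₗ j) (poincareInv (moₗ j).1 (moₗ j).2 x)) → ∀ j, r₀ₙ j < Kerr.radius (aₙ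 j) (poincareInv (moₙ j).1 (moₙ j).2 (Θ x))) → ∃ (U' : Opens E4) (θ : U' → U), (U' : Set E4) = {x : E4 | |x 0 - τ| < 1} ∩ Θ ⁻¹' (U : Set E4) ∩ {x : E4 | ∀ j, r₀ₗ j < Kerr.radius (aₗ j) (poincareInv (moₗ j).1 (moₗ j).2 x)} ∧ (∀ x : U', ((θ x : U) : E4) = Θ x) ∧ ContMDiff 𝓘(ℝ, E4) (𝓡 4) (⊤ : ℕ∞) (Φ ∘ θ) ∧ Topology.IsOpenEmbedding (Φ ∘ θ) ∧ {x : E4 | x 0 = τ ∧ ∀ j, r₀ₗ j < Kerr.radius (aₗ j) (poincareInv (moₗ j).1 (moₗ j).2 x)} ⊆ (U' : Set E4) ∧ range (Φ ∘ θ) ⊆ 𝒟.metric.causalFuture 𝒟.timeOrientation (range 𝒟.embed) ∧ 𝒟.metric.IsAchronal 𝒟.timeOrientation ((Φ ∘ θ) '' {x : ↥U' | (x : E4) 0 = τ}) ∧ (∀ x : U', ∀ v : E4, mfderiv 𝓘(ℝ, E4) (𝓡 4) (Φ ∘ θ) x v = mfderiv 𝓘(ℝ, E4) (𝓡 4) Φ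 (θ x) (fderiv ℝ Θ x v)) ∧ (∀ (Bg Bg' : E4 → E4 →L[ℝ] E4 →L[ℝ] ℝ) (tm tm' rd rd' : E4 → ℝ) (x : U'), 𝒟.toSpacetime.deviationExtend ⟨U', Bg', tm', rd'⟩ (Φ ∘ θ) =ᶠ[𝓝 (x : E4)] fun y ↦ bilinPullback Θ (fun z ↦ 𝒟.toSpacetime.deviationExtend ⟨U, Bg, tm, rd⟩ Φ z + Bg z) y - Bg' y)) → (∀ (k : ℕ) (m₀ χ L₀ : ℝ), 0 < m₀ → ∃ C R₀ : ℝ, 0 < R₀ ∧ ∀ (M a : ℝ) (Λ : ↥lorentzGroup) (c : E4), m₀ ≤ M → M ≤ m₀⁻¹ → |a| ≤ χ * M → (∀ v : E4, ‖(Λ : E4 ≃L[ℝ] E4) v‖ ≤ L₀ * ‖v‖) → ∀ x : E4, R₀ ≤ Kerr.radius a (poincareInv Λ c x) → ∀ m ≤ k, ‖iteratedFDeriv ℝ m (fun y ↦ boostedKerrBilin Λ c M a y - Minkowski.bilin) x‖ ≤ C / Kerr.radius a (poincareInv Λ c x)) → ((∀ (k : ℕ) (m₀ χ L₀ : ℝ),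 0 < m₀ → ∃ C R₀ : ℝ, 0 < R₀ ∧ ∀ (M a : ℝ) (Λ : ↥lorentzGroup) (c : E4), m₀ ≤ M → M ≤ m₀⁻¹ → |a| ≤ χ * M → (∀ v : E4, ‖(Λ : E4 ≃L[ℝ] E4) v‖ ≤ L₀ * ‖v‖) → ∀ x : E4, R₀ ≤ Kerr.radius a (poincareInv Λ c x) → ∀ m ≤ k, ‖iteratedFDeriv ℝ m (fun y ↦ boostedKerrBilin Λ c M a y - Minkowski.bilin) x‖ ≤ C / Kerr.radius a (poincareInv Λ c x)) → ∀ k : ℕ, ∀ (X : Type) [TopologicalSpace X] [ChartedSpace E3 X] [IsManifold (𝓡 3) (⊤ : ℕ∞) X] [T2Space X] [SecondCountableTopology X] [ConnectedSpace X] (D : InitialDataSet (𝓡 3) X) (𝒟 : VacuumCauchyDevelopment D) (N₀ : ℕ) (m₀ χ μ v₀ L₀ : ℝ), 0 < m₀ → ∃ C ρ₀ : ℝ, 0 < ρ₀ ∧ ∀ (N : ℕ) (M a r₀ : Fin N → ℝ) (mo : Fin N → ↥lorentzGroup × E4), (N ≤ N₀ ∧ (∀ i, m₀ ≤ M i ∧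 M i ≤ m₀⁻¹ ∧ |a i| ≤ χ * M i ∧ Kerr.rMinus (M i) (a i) + μ ≤ r₀ i ∧ r₀ i + μ ≤ Kerr.rPlus (M i) (a i) ∧ ∀ v : E4, ‖((mo i).1 : E4 ≃L[ℝ] E4) v‖ ≤ L₀ * ‖v‖) ∧ (∀ i j, i ≠ j → v₀ ≤ ‖(((mo i).1 : E4 ≃L[ℝ] E4) (E4.basisVector 0) 0)⁻¹ • E4.spatial (((mo i).1 : E4 ≃L[ℝ] E4) (E4.basisVector 0)) - (((mo j).1 : E4 ≃L[ℝ] E4) (E4.basisVector 0) 0)⁻¹ • E4.spatial (((mo j).1 : E4 ≃L[ℝ] E4) (E4.basisVector 0))‖)) → ∀ (ε τ : ℝ) (R : Fin N → ℝ) (U : Opens E4) (Φ : U → 𝒟.carrier), 0 ≤ ε → ((∀ i, r₀ i + 1 ≤ R i) ∧ ContMDiff 𝓘(ℝ, E4) (𝓡 4) (⊤ : ℕ∞) Φ ∧ Topology.IsOpenEmbedding Φ ∧ {x : E4 | x 0 = τ ∧ (∀ j, r₀ j < Kerr.radius (a j) (poincareInv (mo j).1 (mo j).2 x))} ⊆ (U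 : Set E4) ∧ range Φ ⊆ 𝒟.metric.causalFuture 𝒟.timeOrientation (range 𝒟.embed) ∧ 𝒟.metric.IsAchronal 𝒟.timeOrientation (Φ '' {x : ↥U | (x : E4) 0 = τ}) ∧ (∀ i, supCkENorm {x : E4 | x 0 = τ ∧ (∀ j, r₀ j < Kerr.radius (a j) (poincareInv (mo j).1 (mo j).2 x)) ∧ Kerr.radius (a i) (poincareInv (mo i).1 (mo i).2 x) ≤ R i} k (𝒟.toSpacetime.deviationExtend ⟨U, boostedKerrBilin (mo i).1 (mo i).2 (M i) (a i), fun x ↦ x 0, fun x ↦ Kerr.radius (a i) (poincareInv (mo i).1 (mo i).2 x)⟩ Φ) ≤ ENNReal.ofReal ε) ∧ supCkENorm {x : E4 | x 0 = τ ∧ (∀ j, r₀ j < Kerr.radius (a j) (poincareInv (mo j).1 (mo j).2 x)) ∧ ∀ j, R j - 1 ≤ Kerr.radius (a j) (poincareInv (mo j).1 (mo j).2 x)} k (𝒟.toSpacetime.deviationExtend (Minkowski.backgroundOn U) Φ) ≤ ENNReal.ofReal ε ∧ (∀ x : ↥U, x.1 0 = τ → (∀ j, R j - 1 ≤ Kerr.radius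 (a j) (poincareInv (mo j).1 (mo j).2 x.1)) → 𝒟.timeOrientation.IsFutureDirected (mfderiv 𝓘(ℝ, E4) (𝓡 4) Φ x (E4.basisVector 0)))) → ∀ z : E4, z 0 = τ → (∀ l, r₀ l < Kerr.radius (a l) (poincareInv (mo l).1 (mo l).2 z)) → ∀ ρ : ℝ, ρ₀ ≤ ρ → (∀ l, ρ ≤ Kerr.radius (a l) (poincareInv (mo l).1 (mo l).2 z)) → ∀ m ≤ k, ‖iteratedFDeriv ℝ m (𝒟.toSpacetime.deviationExtend (Minkowski.backgroundOn U) Φ) z‖ ≤ ε + C / ρ) → (∀ (N₀ : ℕ) (m₀ χ μ v₀ L₀ : ℝ), 0 < m₀ → χ < 1 → 0 < μ → 0 < v₀ → ∀ (N : ℕ) (M a r₀ : Fin N → ℝ) (mo : Fin N → ↥lorentzGroup × E4), (N ≤ N₀ ∧ (∀ i, m₀ ≤ M i ∧ M i ≤ m₀⁻¹ ∧ |a i| ≤ χ * M i ∧ Kerr.rMinus (M i) (a i) + μ ≤ r₀ i ∧ r₀ i + μ ≤ Kerr.rPlus (M i) (a i) ∧ ∀ v : E4, ‖((mo i).1 :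 E4 ≃L[ℝ] E4) v‖ ≤ L₀ * ‖v‖) ∧ (∀ i j, i ≠ j → v₀ ≤ ‖(((mo i).1 : E4 ≃L[ℝ] E4) (E4.basisVector 0) 0)⁻¹ • E4.spatial (((mo i).1 : E4 ≃L[ℝ] E4) (E4.basisVector 0)) - (((mo j).1 : E4 ≃L[ℝ] E4) (E4.basisVector 0) 0)⁻¹ • E4.spatial (((mo j).1 : E4 ≃L[ℝ] E4) (E4.basisVector 0))‖)) → ∀ ρ₁ : ℝ, 0 < ρ₁ → ∃ T : ℝ, ∀ τ : ℝ, T ≤ τ → ∀ (R : Fin N → ℝ) (z : E4), z 0 = τ → (∀ i, ρ₁ ≤ Kerr.radius (a i) (poincareInv (mo i).1 (mo i).2 z)) → ∃ S : Set E4, IsPreconnected S ∧ z ∈ S ∧ (∀ x ∈ S, x 0 = τ ∧ ∀ i, ρ₁ ≤ Kerr.radius (a i) (poincareInv (mo i).1 (mo i).2 x)) ∧ ∃ z₂ ∈ S, ∀ i, R i ≤ Kerr.radius (a i) (poincareInv (mo i).1 (mo i).2 z₂)) → (∀ k : ℕ, ∀ (X : Type) [TopologicalSpace X] [ChartedSpace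 E3 X] [IsManifold (𝓡 3) (⊤ : ℕ∞) X] [T2Space X] [SecondCountableTopology X] [ConnectedSpace X] (D : InitialDataSet (𝓡 3) X) (𝒟 : VacuumCauchyDevelopment D) (N : ℕ) (M a r₀ : Fin N → ℝ) (mo : Fin N → ↥lorentzGroup × E4) (ε τ : ℝ) (R : Fin N → ℝ) (U : Opens E4) (Φ : U → 𝒟.carrier), ((∀ i, r₀ i + 1 ≤ R i) ∧ ContMDiff 𝓘(ℝ, E4) (𝓡 4) (⊤ : ℕ∞) Φ ∧ Topology.IsOpenEmbedding Φ ∧ {x : E4 | x 0 = τ ∧ (∀ j, r₀ j < Kerr.radius (a j) (poincareInv (mo j).1 (mo j).2 x))} ⊆ (U : Set E4) ∧ range Φ ⊆ 𝒟.metric.causalFuture 𝒟.timeOrientation (range 𝒟.embed) ∧ 𝒟.metric.IsAchronal 𝒟.timeOrientation (Φ '' {x : ↥U | (x : E4) 0 = τ}) ∧ (∀ i, supCkENorm {x : E4 | x 0 = τ ∧ (∀ j, r₀ j < Kerr.radius (a j) (poincareInv (mo j).1 (mo j).2 x)) ∧ Kerr.radius (a i) (poincareInv (mo i).1 (mo i).2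 x) ≤ R i} k (𝒟.toSpacetime.deviationExtend ⟨U, boostedKerrBilin (mo i).1 (mo i).2 (M i) (a i), fun x ↦ x 0, fun x ↦ Kerr.radius (a i) (poincareInv (mo i).1 (mo i).2 x)⟩ Φ) ≤ ENNReal.ofReal ε) ∧ supCkENorm {x : E4 | x 0 = τ ∧ (∀ j, r₀ j < Kerr.radius (a j) (poincareInv (mo j).1 (mo j).2 x)) ∧ ∀ j, R j - 1 ≤ Kerr.radius (a j) (poincareInv (mo j).1 (mo j).2 x)} k (𝒟.toSpacetime.deviationExtend (Minkowski.backgroundOn U) Φ) ≤ ENNReal.ofReal ε ∧ (∀ x : ↥U, x.1 0 = τ → (∀ j, R j - 1 ≤ Kerr.radius (a j) (poincareInv (mo j).1 (mo j).2 x.1)) → 𝒟.timeOrientation.IsFutureDirected (mfderiv 𝓘(ℝ, E4) (𝓡 4) Φ x (E4.basisVector 0)))) → ∀ S : Set E4, IsPreconnected S → S ⊆ {x : E4 | x 0 = τ ∧ ∀ j, r₀ j < Kerr.radius (a j) (poincareInv (mo j).1 (mo j).2 x)} → (∀ x ∈ S, ‖𝒟.toSpacetime.deviationExtend (Minkowski.backgroundOn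 U) Φ x‖ < 1) → (∃ z₂ ∈ S, ∀ j, R j - 1 ≤ Kerr.radius (a j) (poincareInv (mo j).1 (mo j).2 z₂)) → ∀ x : ↥U, x.1 ∈ S → 𝒟.timeOrientation.IsFutureDirected (mfderiv 𝓘(ℝ, E4) (𝓡 4) Φ x (E4.basisVector 0))) → (∀ (k N : ℕ) (L₀ η : ℝ), 1 ≤ L₀ → 0 < η → ∃ δ : ℝ, 0 < δ ∧ ∀ (Λn Λl : Fin N → ↥lorentzGroup) (cn cl : Fin N → E4) (τ ϱ : ℝ), 1 ≤ ϱ → (∀ j, ‖(((Λl j : ↥lorentzGroup) : E4 ≃L[ℝ] E4) : E4 →L[ℝ] E4)‖ ≤ L₀ ∧ ‖((((Λl j : ↥lorentzGroup) : E4 ≃L[ℝ] E4)).symm : E4 →L[ℝ] E4)‖ ≤ L₀ ∧ ‖(((Λn j : ↥lorentzGroup) : E4 ≃L[ℝ] E4) : E4 →L[ℝ] E4)‖ ≤ L₀ ∧ ‖(((Λn j : ↥lorentzGroup) : E4 ≃L[ℝ] E4) : E4 →L[ℝ] E4) - (((Λl j : ↥lorentzGroup) : E4 ≃L[ℝ]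 E4) : E4 →L[ℝ] E4)‖ ≤ δ) → (∀ j, ‖(E4.spatial (cn j) + ((τ) - (cn j) 0) • (((((Λn j : ↥lorentzGroup) : E4 ≃L[ℝ] E4)) (E4.basisVector 0) 0)⁻¹ • E4.spatial ((((Λn j : ↥lorentzGroup) : E4 ≃L[ℝ] E4)) (E4.basisVector 0)))) - (E4.spatial (cl j) + ((τ) - (cl j) 0) • (((((Λl j : ↥lorentzGroup) : E4 ≃L[ℝ] E4)) (E4.basisVector 0) 0)⁻¹ • E4.spatial ((((Λl j : ↥lorentzGroup) : E4 ≃L[ℝ] E4)) (E4.basisVector 0))))‖ ≤ δ * ϱ) → (∀ i j, i ≠ j → 16 * ϱ ≤ ‖(E4.spatial (cl i) + ((τ) - (cl i) 0) • (((((Λl i : ↥lorentzGroup) : E4 ≃L[ℝ] E4)) (E4.basisVector 0) 0)⁻¹ • E4.spatial ((((Λl i : ↥lorentzGroup) : E4 ≃L[ℝ] E4)) (E4.basisVector 0)))) - (E4.spatial (cl j) + ((τ) - (cl j) 0) • (((((Λl j : ↥lorentzGroup) : E4 ≃L[ℝ] E4)) (E4.basisVector 0) 0)⁻¹ • E4.spatial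 ((((Λl j : ↥lorentzGroup) : E4 ≃L[ℝ] E4)) (E4.basisVector 0))))‖) → ∃ (Θ : E4 → E4) (T : Fin N → E4 →L[ℝ] E4) (β : Fin N → ℝ), ContDiff ℝ (⊤ : ℕ∞) Θ ∧ (∀ x, (Θ x) 0 = x 0) ∧ (∀ x : E4, |x 0 - τ| < 1 → ‖fderiv ℝ Θ x - ContinuousLinearMap.id ℝ E4‖ ≤ η ∧ ‖Θ x - x‖ ≤ η * ϱ ∧ ∀ m : ℕ, 2 ≤ m → m ≤ k + 1 → ‖iteratedFDeriv ℝ m Θ x‖ ≤ η) ∧ Topology.IsOpenEmbedding ({x : E4 | |x 0 - τ| < 1}.restrict Θ) ∧ (∀ j, ‖T j - ((((Λl j : ↥lorentzGroup) : E4 ≃L[ℝ] E4)).symm : E4 →L[ℝ] E4)‖ ≤ η ∧ (∃ κ : ℝ, T j (((Λl j : ↥lorentzGroup) : E4 ≃L[ℝ] E4) (E4.basisVector 0)) = κ • E4.basisVector 0) ∧ ∀ x : E4, |x 0 - τ| < 1 → ‖E4.spatial x - (E4.spatial (cl j) + ((τ) - (cl j) 0) • (((((Λl j : ↥lorentzGroup)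 : E4 ≃L[ℝ] E4)) (E4.basisVector 0) 0)⁻¹ • E4.spatial ((((Λl j : ↥lorentzGroup) : E4 ≃L[ℝ] E4)) (E4.basisVector 0))))‖ ≤ ϱ → fderiv ℝ Θ x = (((Λn j : ↥lorentzGroup) : E4 ≃L[ℝ] E4) : E4 →L[ℝ] E4).comp (T j) ∧ poincareInv (Λn j) (cn j) (Θ x) = T j (x - cl j) + β j • E4.basisVector 0)) → (∀ k : ℕ, ∀ (X : Type) [TopologicalSpace X] [ChartedSpace E3 X] [IsManifold (𝓡 3) (⊤ : ℕ∞) X] [T2Space X] [SecondCountableTopology X] [ConnectedSpace X] (D : InitialDataSet (𝓡 3) X) (𝒟 : VacuumCauchyDevelopment D) (N₀ : ℕ) (m₀ χ μ v₀ L₀ : ℝ), 0 < m₀ → χ < 1 → 0 < μ → 0 < v₀ → ∀ R₁ : ℝ, ∃ ε₀ : ℝ, 0 < ε₀ ∧ ∀ (N : ℕ) (M a r₀ : Fin N → ℝ) (mo : Fin N → ↥lorentzGroup × E4), (N ≤ N₀ ∧ (∀ i, m₀ ≤ M i ∧ M i ≤ m₀⁻¹ ∧ |a i| ≤ χ * M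 i ∧ Kerr.rMinus (M i) (a i) + μ ≤ r₀ i ∧ r₀ i + μ ≤ Kerr.rPlus (M i) (a i) ∧ ∀ v : E4, ‖((mo i).1 : E4 ≃L[ℝ] E4) v‖ ≤ L₀ * ‖v‖) ∧ (∀ i j, i ≠ j → v₀ ≤ ‖(((mo i).1 : E4 ≃L[ℝ] E4) (E4.basisVector 0) 0)⁻¹ • E4.spatial (((mo i).1 : E4 ≃L[ℝ] E4) (E4.basisVector 0)) - (((mo j).1 : E4 ≃L[ℝ] E4) (E4.basisVector 0) 0)⁻¹ • E4.spatial (((mo j).1 : E4 ≃L[ℝ] E4) (E4.basisVector 0))‖)) → ∃ T : ℝ, ∀ τ : ℝ, T ≤ τ → ∀ ε : ℝ, 0 < ε → ε ≤ ε₀ → ∀ (R : Fin N → ℝ) (U : Opens E4) (Φ : U → 𝒟.carrier), ((∀ i, r₀ i + 1 ≤ R i) ∧ ContMDiff 𝓘(ℝ, E4) (𝓡 4) (⊤ : ℕ∞) Φ ∧ Topology.IsOpenEmbedding Φ ∧ {x : E4 | x 0 = τ ∧ (∀ j, r₀ j < Kerr.radius (a j) (poincareInv (mo j).1 (mo j).2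 x))} ⊆ (U : Set E4) ∧ range Φ ⊆ 𝒟.metric.causalFuture 𝒟.timeOrientation (range 𝒟.embed) ∧ 𝒟.metric.IsAchronal 𝒟.timeOrientation (Φ '' {x : ↥U | (x : E4) 0 = τ}) ∧ (∀ i, supCkENorm {x : E4 | x 0 = τ ∧ (∀ j, r₀ j < Kerr.radius (a j) (poincareInv (mo j).1 (mo j).2 x)) ∧ Kerr.radius (a i) (poincareInv (mo i).1 (mo i).2 x) ≤ R i} k (𝒟.toSpacetime.deviationExtend ⟨U, boostedKerrBilin (mo i).1 (mo i).2 (M i) (a i), fun x ↦ x 0, fun x ↦ Kerr.radius (a i) (poincareInv (mo i).1 (mo i).2 x)⟩ Φ) ≤ ENNReal.ofReal ε) ∧ supCkENorm {x : E4 | x 0 = τ ∧ (∀ j, r₀ j < Kerr.radius (a j) (poincareInv (mo j).1 (mo j).2 x)) ∧ ∀ j, R j - 1 ≤ Kerr.radius (a j) (poincareInv (mo j).1 (mo j).2 x)} k (𝒟.toSpacetime.deviationExtend (Minkowski.backgroundOn U) Φ) ≤ ENNReal.ofReal ε ∧ (∀ x : ↥U, x.1 0 = τ → (∀ j, R j -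 1 ≤ Kerr.radius (a j) (poincareInv (mo j).1 (mo j).2 x.1)) → 𝒟.timeOrientation.IsFutureDirected (mfderiv 𝓘(ℝ, E4) (𝓡 4) Φ x (E4.basisVector 0)))) → ∀ j, R₁ ≤ R j) → (∀ (N : ℕ) (X : Fin N → E3) (z : E3) (ρ D : ℝ), 0 < ρ → 32 * ((N : ℝ) + 1) * ρ ≤ D → (∀ i, D ≤ ‖z - X i‖) → ∃ e : E3, ‖e‖ = 1 ∧ ∀ i, ∀ s : ℝ, 0 ≤ s → ρ ≤ ‖z + s • e - X i‖) → (∀ (k : ℕ) (Mseq aseq : ℕ → ℝ) (Tseq : ℕ → E4 →L[ℝ] E4) (Mₗ aₗ : ℝ) (Λₗ : ↥lorentzGroup) (cₗ : E4) (ρ₁ ρ₂ : ℝ), 0 < ρ₁ → Tendsto Mseq atTop (𝓝 Mₗ) → Tendsto aseq atTop (𝓝 aₗ) → Tendsto Tseq atTop (𝓝 ((Λₗ : E4 ≃L[ℝ] E4).symm : E4 →L[ℝ] E4)) → (∀ n, ∃ κ : ℝ, Tseq n ((Λₗ : E4 ≃L[ℝ] E4) (E4.basisVector 0)) = κ • E4.basisVector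 0) → ∀ δ : ℝ, 0 < δ → ∀ᶠ n in atTop, ∀ i ≤ k, ∀ x : E4, ρ₁ ≤ Kerr.radius aₗ (poincareInv Λₗ cₗ x) → Kerr.radius aₗ (poincareInv Λₗ cₗ x) ≤ ρ₂ → ‖iteratedFDeriv ℝ i (fun z ↦ (ContinuousLinearMap.precomp ℝ (Tseq n)).comp ((Kerr.bilin (Mseq n) (aseq n) (Tseq n (z - cₗ))).comp (Tseq n))) x - iteratedFDeriv ℝ i (boostedKerrBilin Λₗ cₗ Mₗ aₗ) x‖ ≤ δ) → ∀ k : ℕ, ∀ (X : Type) [TopologicalSpace X] [ChartedSpace E3 X] [IsManifold (𝓡 3) (⊤ : ℕ∞) X] [T2Space X] [SecondCountableTopology X] [ConnectedSpace X] (D : InitialDataSet (𝓡 3) X) (𝒟 : VacuumCauchyDevelopment D) (N₀ : ℕ) (m₀ χ μ v₀ L₀ : ℝ), 0 < m₀ → χ < 1 → 0 < μ → 0 < v₀ → ∀ (N : ℕ) (M a r₀ : ℕ → Fin N → ℝ) (mo : ℕ → Fin N → ↥lorentzGroup × E4) (Mₗ aₗ rₗ r₀ₗ : Fin N → ℝ)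 (moₗ : Fin N → ↥lorentzGroup × E4), (∀ n, N ≤ N₀ ∧ (∀ i, m₀ ≤ M n i ∧ M n i ≤ m₀⁻¹ ∧ |a n i| ≤ χ * M n i ∧ Kerr.rMinus (M n i) (a n i) + μ ≤ r₀ n i ∧ r₀ n i + μ ≤ Kerr.rPlus (M n i) (a n i) ∧ ∀ v : E4, ‖((mo n i).1 : E4 ≃L[ℝ] E4) v‖ ≤ L₀ * ‖v‖) ∧ (∀ i j, i ≠ j → v₀ ≤ ‖(((mo n i).1 : E4 ≃L[ℝ] E4) (E4.basisVector 0) 0)⁻¹ • E4.spatial (((mo n i).1 : E4 ≃L[ℝ] E4) (E4.basisVector 0)) - (((mo n j).1 : E4 ≃L[ℝ] E4) (E4.basisVector 0) 0)⁻¹ • E4.spatial (((mo n j).1 : E4 ≃L[ℝ] E4) (E4.basisVector 0))‖)) → (∀ i, Tendsto (fun n ↦ M n i) atTop (𝓝 (Mₗ i))) → (∀ i, Tendsto (fun n ↦ a n i) atTop (𝓝 (aₗ i))) → (∀ i, Tendsto (fun n ↦ r₀ n i) atTop (𝓝 (rₗ i))) → (∀ i, Tendsto (fun n ↦ (((mo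 n i).1 : E4 ≃L[ℝ] E4) : E4 →L[ℝ] E4)) atTop (𝓝 (((moₗ i).1 : E4 ≃L[ℝ] E4) : E4 →L[ℝ] E4))) → (∀ i, Tendsto (fun n ↦ (((mo n i).1 : E4 ≃L[ℝ] E4).symm : E4 →L[ℝ] E4)) atTop (𝓝 (((moₗ i).1 : E4 ≃L[ℝ] E4).symm : E4 →L[ℝ] E4))) → (N ≤ N₀ ∧ (∀ i, m₀ ≤ Mₗ i ∧ Mₗ i ≤ m₀⁻¹ ∧ |aₗ i| ≤ χ * Mₗ i ∧ Kerr.rMinus (Mₗ i) (aₗ i) + μ ≤ rₗ i ∧ rₗ i + μ ≤ Kerr.rPlus (Mₗ i) (aₗ i) ∧ ∀ v : E4, ‖((moₗ i).1 : E4 ≃L[ℝ] E4) v‖ ≤ L₀ * ‖v‖) ∧ (∀ i j, i ≠ j → v₀ ≤ ‖(((moₗ i).1 : E4 ≃L[ℝ] E4) (E4.basisVector 0) 0)⁻¹ • E4.spatial (((moₗ i).1 : E4 ≃L[ℝ] E4) (E4.basisVector 0)) - (((moₗ j).1 : E4 ≃L[ℝ] E4) (E4.basisVector 0) 0)⁻¹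 • E4.spatial (((moₗ j).1 : E4 ≃L[ℝ] E4) (E4.basisVector 0))‖)) → (∀ i, r₀ₗ i = rₗ i + μ / 2) → ∀ ε' : ℝ, 0 < ε' → ∃ (n₀ : ℕ) (ε₀ : ℝ), 0 < ε₀ ∧ ∀ n, n₀ ≤ n → ∃ T : ℝ, ∀ τ : ℝ, T ≤ τ → ∀ ε : ℝ, 0 < ε → ε ≤ ε₀ → (∃ (R : Fin N → ℝ) (U : Opens E4) (Φ : U → 𝒟.carrier), (∀ i, r₀ n i + 1 ≤ R i) ∧ ContMDiff 𝓘(ℝ, E4) (𝓡 4) (⊤ : ℕ∞) Φ ∧ Topology.IsOpenEmbedding Φ ∧ {x : E4 | x 0 = τ ∧ (∀ j, r₀ n j < Kerr.radius (a n j) (poincareInv (mo n j).1 (mo n j).2 x))} ⊆ (U : Set E4) ∧ range Φ ⊆ 𝒟.metric.causalFuture 𝒟.timeOrientation (range 𝒟.embed) ∧ 𝒟.metric.IsAchronal 𝒟.timeOrientation (Φ '' {x : ↥U | (x : E4) 0 = τ}) ∧ (∀ i, supCkENorm {x : E4 | x 0 = τ ∧ (∀ j, r₀ n j < Kerr.radius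 (a n j) (poincareInv (mo n j).1 (mo n j).2 x)) ∧ Kerr.radius (a n i) (poincareInv (mo n i).1 (mo n i).2 x) ≤ R i} k (𝒟.toSpacetime.deviationExtend ⟨U, boostedKerrBilin (mo n i).1 (mo n i).2 (M n i) (a n i), fun x ↦ x 0, fun x ↦ Kerr.radius (a n i) (poincareInv (mo n i).1 (mo n i).2 x)⟩ Φ) ≤ ENNReal.ofReal ε) ∧ supCkENorm {x : E4 | x 0 = τ ∧ (∀ j, r₀ n j < Kerr.radius (a n j) (poincareInv (mo n j).1 (mo n j).2 x)) ∧ ∀ j, R j - 1 ≤ Kerr.radius (a n j) (poincareInv (mo n j).1 (mo n j).2 x)} k (𝒟.toSpacetime.deviationExtend (Minkowski.backgroundOn U) Φ) ≤ ENNReal.ofReal ε ∧ (∀ x : ↥U, x.1 0 = τ → (∀ j, R j - 1 ≤ Kerr.radius (a n j) (poincareInv (mo n j).1 (mo n j).2 x.1)) → 𝒟.timeOrientation.IsFutureDirected (mfderiv 𝓘(ℝ, E4) (𝓡 4) Φ x (E4.basisVector 0)))) → ∃ (R : Fin N → ℝ) (U : Opens E4) (Φ : U → 𝒟.carrier), (∀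 i, r₀ₗ i + 1 ≤ R i) ∧ ContMDiff 𝓘(ℝ, E4) (𝓡 4) (⊤ : ℕ∞) Φ ∧ Topology.IsOpenEmbedding Φ ∧ {x : E4 | x 0 = τ ∧ (∀ j, r₀ₗ j < Kerr.radius (aₗ j) (poincareInv (moₗ j).1 (moₗ j).2 x))} ⊆ (U : Set E4) ∧ range Φ ⊆ 𝒟.metric.causalFuture 𝒟.timeOrientation (range 𝒟.embed) ∧ 𝒟.metric.IsAchronal 𝒟.timeOrientation (Φ '' {x : ↥U | (x : E4) 0 = τ}) ∧ (∀ i, supCkENorm {x : E4 | x 0 = τ ∧ (∀ j, r₀ₗ j < Kerr.radius (aₗ j) (poincareInv (moₗ j).1 (moₗ j).2 x)) ∧ Kerr.radius (aₗ i) (poincareInv (moₗ i).1 (moₗ i).2 x) ≤ R i} k (𝒟.toSpacetime.deviationExtend ⟨U, boostedKerrBilin (moₗ i).1 (moₗ i).2 (Mₗ i) (aₗ i), fun x ↦ x 0, fun x ↦ Kerr.radius (aₗ i) (poincareInv (moₗ i).1 (moₗ i).2 x)⟩ Φ) ≤ ENNReal.ofReal ε') ∧ supCkENorm {x : E4 |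 x 0 = τ ∧ (∀ j, r₀ₗ j < Kerr.radius (aₗ j) (poincareInv (moₗ j).1 (moₗ j).2 x)) ∧ ∀ j, R j - 1 ≤ Kerr.radius (aₗ j) (poincareInv (moₗ j).1 (moₗ j).2 x)} k (𝒟.toSpacetime.deviationExtend (Minkowski.backgroundOn U) Φ) ≤ ENNReal.ofReal ε' ∧ (∀ x : ↥U, x.1 0 = τ → (∀ j, R j - 1 ≤ Kerr.radius (aₗ j) (poincareInv (moₗ j).1 (moₗ j).2 x.1)) → 𝒟.timeOrientation.IsFutureDirected (mfderiv 𝓘(ℝ, E4) (𝓡 4) Φ x (E4.basisVector 0))) := by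
  intro hA' hPS hG hGtoB hC1 hC2 hA hT2a hT2b hT2c k X _ _ _ _ _ _ D 𝒟 N₀ m₀ χ μ v₀ L₀ hm₀ hχ hμ hv₀ N M a
    r₀ mo Mₗ aₗ rₗ r₀ₗ moₗ hmarg hM ha hr hΛ hΛs hmargₗ hr₀ₗ ε' hε'
  clear hPS hC2 hA hT2b hΛs
  -- metric form of convergence: eventually `‖u n − b‖ ≤ δ`
  have eventually_norm_sub_le : ∀ {E : Type} [SeminormedAddCommGroup E] {u : ℕ → E} {b : E},
      Tendsto u atTop (𝓝 b) → ∀ {δ : ℝ}, 0 < δ → ∀ᶠ n in atTop, ‖u n - b‖ ≤ δ :=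
    fun h δ hδ ↦ (Metric.tendsto_nhds.1 h δ hδ).mono fun n hn ↦ by
      rw [dist_eq_norm] at hn
      exact hn.le
  /- STEP 0: constants depending on `k`, the margins and `ε'` only -/
  obtain ⟨Ak, hAk⟩ : ∃ Ak : ℝ, Ak = 4 ^ k * (k.factorial : ℝ) * 2 ^ (k + 2) := ⟨_, rfl⟩
  have hAk0 : 0 < Ak := by rw [hAk]; positivity
  obtain ⟨Bk, hBk⟩ : ∃ Bk : ℝ, Bk = 2 ^ (k + 2) * ‖Minkowski.bilin‖ := ⟨_, rfl⟩
  have hBk0 : 0 ≤ Bk := by rw [hBk]; positivity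
  -- far-field flatness constants (B, conditional on G)
  obtain ⟨CB, ρB, hρB, hBall⟩ := hGtoB hG k X D 𝒟 N₀ m₀ χ μ v₀ L₀ hm₀
  obtain ⟨cB, hcB⟩ : ∃ cB : ℝ, cB = max CB 0 := ⟨_, rfl⟩
  have hcB0 : 0 ≤ cB := by rw [hcB]; exact le_max_right _ _
  have hCBc : CB ≤ cB := by rw [hcB]; exact le_max_left _ _
  -- the radius `R̄`
  have hm₀' : 0 < m₀⁻¹ := inv_pos.2 hm₀
  obtain ⟨Rb, hRb⟩ : ∃ Rb : ℝ, Rb = 2 * m₀⁻¹ + ρB + 3 + cB * (16 + 4 * Ak / ε') := ⟨_, rfl⟩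
  have hAkε : 0 ≤ 4 * Ak / ε' := by positivity
  have hcBt : cB * 16 ≤ cB * (16 + 4 * Ak / ε') := mul_le_mul_of_nonneg_left (by linarith) hcB0
  have hcBt' : cB * (4 * Ak / ε') ≤ cB * (16 + 4 * Ak / ε') :=
    mul_le_mul_of_nonneg_left (by linarith) hcB0
  have hRb3 : 2 * m₀⁻¹ + 3 ≤ Rb := by rw [hRb]; nlinarith
  have hRb2 : 2 ≤ Rb := by linarith
  have hRb1 : 0 < Rb - 1 := by linarith
  have hρBRb : ρB ≤ Rb - 1 := by rw [hRb]; nlinarith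
  have hcB1 : cB / (Rb - 1) ≤ 1 / 16 := by
    rw [div_le_iff₀ hRb1, hRb]; nlinarith
  have hcB2 : Ak * (cB / (Rb - 1)) ≤ ε' / 4 := by
    have h1 : cB * (4 * Ak) ≤ ε' * (Rb - 1) := by
      have h2 : cB * (4 * Ak / ε') ≤ Rb - 1 := by rw [hRb]; nlinarith
      have h3 := mul_le_mul_of_nonneg_left h2 hε'.le
      calc cB * (4 * Ak) = ε' * (cB * (4 * Ak / ε')) := by field_simp
        _ ≤ ε' * (Rb - 1) := h3
    rw [mul_div_assoc', div_le_iff₀ hRb1]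
    linarith
  -- `η` and the re-anchoring constant
  obtain ⟨η, hη⟩ : ∃ η : ℝ, η = min (1 / 8) (ε' / (4 * (Bk + 1))) := ⟨_, rfl⟩
  have hη0 : 0 < η := by rw [hη]; exact lt_min (by norm_num) (by positivity)
  have hη8 : η ≤ 1 / 8 := by rw [hη]; exact min_le_left _ _
  have hBkη : Bk * η ≤ ε' / 4 := by
    have h1 : η ≤ ε' / (4 * (Bk + 1)) := by rw [hη]; exact min_le_right _ _
    have h2 : Bk * (ε' / (4 * (Bk + 1))) ≤ ε' / 4 := by
      rw [mul_div_assoc', div_le_div_iff₀ (by positivity) (by norm_num)]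
      nlinarith
    exact (mul_le_mul_of_nonneg_left h1 hBk0).trans h2
  obtain ⟨L₀', hL₀'⟩ : ∃ L₀' : ℝ, L₀' = 1 + 3 * max L₀ 0 := ⟨_, rfl⟩
  have hL₀m : L₀ ≤ max L₀ 0 := le_max_left _ _
  have hL₀m0 : 0 ≤ max L₀ 0 := le_max_right _ _
  have hL₀'1 : 1 ≤ L₀' := by rw [hL₀']; linarith
  have hL₀L : L₀ ≤ L₀' := by rw [hL₀']; linarith
  obtain ⟨δA, hδA, hA'all⟩ := hA' k N L₀' η hL₀'1 hη0
  obtain ⟨δ', hδ'⟩ : ∃ δ' : ℝ, δ' = min δA (1 / 8) := ⟨_, rfl⟩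
  have hδ'0 : 0 < δ' := by rw [hδ']; exact lt_min hδA (by norm_num)
  have hδ'A : δ' ≤ δA := by rw [hδ']; exact min_le_left _ _
  have hδ'8 : δ' ≤ 1 / 8 := by rw [hδ']; exact min_le_right _ _
  -- the accuracy threshold (T2a at the target radius `R̄ + 3`)
  obtain ⟨εb, hεb, hT2a'⟩ := hT2a k X D 𝒟 N₀ m₀ χ μ v₀ L₀ hm₀ hχ hμ hv₀ (Rb + 3)
  obtain ⟨ε₀, hε₀⟩ : ∃ ε₀ : ℝ, ε₀ = min εb (min (1 / 16) (ε' / (4 * Ak))) := ⟨_, rfl⟩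
  have hε₀0 : 0 < ε₀ := by rw [hε₀]; exact lt_min hεb (lt_min (by norm_num) (by positivity))
  have hε₀b : ε₀ ≤ εb := by rw [hε₀]; exact min_le_left _ _
  have hε₀16 : ε₀ ≤ 1 / 16 := by rw [hε₀]; exact (min_le_right _ _).trans (min_le_left _ _)
  have hε₀A : Ak * ε₀ ≤ ε' / 4 := by
    have h1 : ε₀ ≤ ε' / (4 * Ak) := by rw [hε₀]; exact (min_le_right _ _).trans (min_le_right _ _)
    calc Ak * ε₀ ≤ Ak * (ε' / (4 * Ak)) := mul_le_mul_of_nonneg_left h1 hAk0.le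
      _ = ε' / 4 := by field_simp
  obtain ⟨f₀, hf₀⟩ : ∃ f₀ : ℝ, f₀ = ε₀ + cB / (Rb - 1) := ⟨_, rfl⟩
  have hf₀0 : 0 ≤ f₀ := by rw [hf₀]; positivity
  have hf₀8 : f₀ ≤ 1 / 8 := by rw [hf₀]; linarith
  -- unpacked margins of the configurations
  have hmf : ∀ n i, 0 < M n i ∧ |a n i| ≤ m₀⁻¹ ∧ μ ≤ r₀ n i := fun n i ↦
    margin_facts hm₀ hχ ((hmarg n).2.1 i).1 ((hmarg n).2.1 i).2.1 ((hmarg n).2.1 i).2.2.1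
      ((hmarg n).2.1 i).2.2.2.1
  have hmfₗ : ∀ i, 0 < Mₗ i ∧ |aₗ i| ≤ m₀⁻¹ ∧ μ ≤ rₗ i := fun i ↦
    margin_facts hm₀ hχ (hmargₗ.2.1 i).1 (hmargₗ.2.1 i).2.1 (hmargₗ.2.1 i).2.2.1
      (hmargₗ.2.1 i).2.2.2.1
  have hr₀b : ∀ n i, r₀ n i + 2 ≤ Rb := fun n i ↦ by
    have h1 := ((hmarg n).2.1 i).2.2.2.2.1
    have h2 := Kerr.rPlus_le_two_mul_self (hmf n i).1.le (a n i)
    have h3 := ((hmarg n).2.1 i).2.1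
    linarith
  have hrₗb : ∀ i, r₀ₗ i + 2 ≤ Rb := fun i ↦ by
    have h1 := (hmargₗ.2.1 i).2.2.2.2.1
    have h2 := Kerr.rPlus_le_two_mul_self (hmfₗ i).1.le (aₗ i)
    have h3 := (hmargₗ.2.1 i).2.1
    rw [hr₀ₗ]
    linarith
  -- operator norms of the frames
  have hΛn : ∀ n j, ‖(((mo n j).1 : E4 ≃L[ℝ] E4) : E4 →L[ℝ] E4)‖ ≤ L₀' := fun n j ↦
    ContinuousLinearMap.opNorm_le_bound _ (by linarith) fun v ↦
      (((hmarg n).2.1 j).2.2.2.2.2 v).trans (mul_le_mul_of_nonneg_right hL₀L (norm_nonneg v))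
  have hΛl : ∀ j, ‖(((moₗ j).1 : E4 ≃L[ℝ] E4) : E4 →L[ℝ] E4)‖ ≤ L₀' := fun j ↦
    ContinuousLinearMap.opNorm_le_bound _ (by linarith) fun v ↦
      ((hmargₗ.2.1 j).2.2.2.2.2 v).trans (mul_le_mul_of_nonneg_right hL₀L (norm_nonneg v))
  have hΛls : ∀ j, ‖((((moₗ j).1 : E4 ≃L[ℝ] E4).symm : E4 ≃L[ℝ] E4) : E4 →L[ℝ] E4)‖ ≤ L₀' := fun j ↦ by
    refine (norm_lorentz_symm_le (moₗ j).1).trans ?_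
    have h1 := PiLp.norm_apply_le (((moₗ j).1 : E4 ≃L[ℝ] E4) (E4.basisVector 0)) 0
    rw [Real.norm_eq_abs] at h1
    have h2 := (hmargₗ.2.1 j).2.2.2.2.2 (E4.basisVector 0)
    rw [show ‖(E4.basisVector 0 : E4)‖ = 1 by simp [E4.basisVector], mul_one] at h2
    rw [hL₀']
    linarith
  -- the explicit shear frames of the re-anchoring maps, and the lab velocities
  set TF : ℕ → Fin N → E4 →L[ℝ] E4 := fun n j ↦ (ContinuousLinearMap.id ℝ E4 + ((((((mo n j).1 : E4 ≃L[ℝ] E4) (E4.basisVector 0)) 0))⁻¹ • ((E4.dx 0).comp (((moₗ j).1 : E4 ≃L[ℝ] E4) : E4 →L[ℝ] E4) - (E4.dx 0).comp (((mo n j).1 : E4 ≃L[ℝ] E4) : E4 →L[ℝ] E4))).smulRight (E4.basisVector 0)).comp ((((moₗ j).1 : E4 ≃L[ℝ] E4).symm : E4 ≃L[ℝ] E4) : E4 →L[ℝ] E4) with hTF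
  set Vf : ↥lorentzGroup × E4 → E3 := fun q ↦ (((q.1 : E4 ≃L[ℝ] E4) (E4.basisVector 0)) 0)⁻¹ • E4.spatial ((q.1 : E4 ≃L[ℝ] E4) (E4.basisVector 0)) with hVf
  have hφb : ∀ n j, ‖((((((mo n j).1 : E4 ≃L[ℝ] E4) (E4.basisVector 0)) 0))⁻¹ • ((E4.dx 0).comp (((moₗ j).1 : E4 ≃L[ℝ] E4) : E4 →L[ℝ] E4) - (E4.dx 0).comp (((mo n j).1 : E4 ≃L[ℝ] E4) : E4 →L[ℝ] E4)))‖ ≤ ‖(((mo n j).1 : E4 ≃L[ℝ] E4) : E4 →L[ℝ] E4) - (((moₗ j).1 : E4 ≃L[ℝ] E4) : E4 →L[ℝ] E4)‖ := fun n j ↦ by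
    rw [← ContinuousLinearMap.comp_sub, norm_smul, norm_inv, Real.norm_eq_abs]
    have h1 : ‖(E4.dx 0).comp ((((moₗ j).1 : E4 ≃L[ℝ] E4) : E4 →L[ℝ] E4) - (((mo n j).1 : E4 ≃L[ℝ] E4) : E4 →L[ℝ] E4))‖ ≤ ‖(((mo n j).1 : E4 ≃L[ℝ] E4) : E4 →L[ℝ] E4) - (((moₗ j).1 : E4 ≃L[ℝ] E4) : E4 →L[ℝ] E4)‖ := by
      refine (ContinuousLinearMap.opNorm_comp_le _ _).trans ?_
      rw [norm_sub_rev]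
      calc ‖E4.dx 0‖ * _ ≤ 1 * _ := mul_le_mul_of_nonneg_right
            SublinearIsFree.Slaving.momCap_norm_dx_zero_le (norm_nonneg _)
        _ = _ := one_mul _
    calc _ ≤ 1 * ‖(((mo n j).1 : E4 ≃L[ℝ] E4) : E4 →L[ℝ] E4) - (((moₗ j).1 : E4 ≃L[ℝ] E4) : E4 →L[ℝ] E4)‖ :=
          mul_le_mul (inv_le_one_of_one_le₀ (one_le_abs_lorentz_apply_zero (mo n j).1)) h1
            (norm_nonneg _) zero_le_one
      _ = _ := one_mul _
  have hTFb : ∀ n j, ‖TF n j - ((((moₗ j).1 : E4 ≃L[ℝ] E4).symm : E4 ≃L[ℝ] E4) : E4 →L[ℝ] E4)‖ ≤ ‖(((mo n j).1 : E4 ≃L[ℝ] E4) : E4 →L[ℝ] E4) - (((moₗ j).1 : E4 ≃L[ℝ] E4) : E4 →L[ℝ] E4)‖ * ‖((((moₗ j).1 : E4 ≃L[ℝ] E4).symm : E4 ≃L[ℝ] E4) : E4 →L[ℝ] E4)‖ := fun n j ↦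
    (rme_norm_frame_sub_le (φ := ((((((mo n j).1 : E4 ≃L[ℝ] E4) (E4.basisVector 0)) 0))⁻¹ • ((E4.dx 0).comp (((moₗ j).1 : E4 ≃L[ℝ] E4) : E4 →L[ℝ] E4) - (E4.dx 0).comp (((mo n j).1 : E4 ≃L[ℝ] E4) : E4 →L[ℝ] E4)))) (Λl := (moₗ j).1) (T := TF n j) rfl).trans
      (mul_le_mul_of_nonneg_right (hφb n j) (norm_nonneg _))
  have hTFlim : ∀ j, Tendsto (fun n ↦ TF n j) atTop (𝓝 ((((moₗ j).1 : E4 ≃L[ℝ] E4).symm : E4 ≃L[ℝ] E4) : E4 →L[ℝ] E4)) := fun j ↦ by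
    rw [tendsto_iff_norm_sub_tendsto_zero]
    refine squeeze_zero (fun n ↦ norm_nonneg _) (fun n ↦ hTFb n j) ?_
    have h := (tendsto_iff_norm_sub_tendsto_zero.1 (hΛ j)).mul_const ‖((((moₗ j).1 : E4 ≃L[ℝ] E4).symm : E4 ≃L[ℝ] E4) : E4 →L[ℝ] E4)‖
    rwa [zero_mul] at h
  have hTFκ : ∀ j n, ∃ κ : ℝ, TF n j (((moₗ j).1 : E4 ≃L[ℝ] E4) (E4.basisVector 0)) =
      κ • E4.basisVector 0 := fun j n ↦
    ⟨_, rme_frame_apply_lorentz_basisVector (φ := ((((((mo n j).1 : E4 ≃L[ℝ] E4) (E4.basisVector 0)) 0))⁻¹ • ((E4.dx 0).comp (((moₗ j).1 : E4 ≃L[ℝ] E4) : E4 →L[ℝ] E4) - (E4.dx 0).comp (((mo n j).1 : E4 ≃L[ℝ] E4) : E4 →L[ℝ] E4)))) (Λl := (moₗ j).1) (T := TF n j) rfl⟩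
  have hVlim : ∀ j, Tendsto (fun n ↦ Vf (mo n j)) atTop (𝓝 (Vf (moₗ j))) := fun j ↦ by
    have h1 : Tendsto (fun n ↦ (((mo n j).1 : E4 ≃L[ℝ] E4) : E4 →L[ℝ] E4) (E4.basisVector 0)) atTop
        (𝓝 ((((moₗ j).1 : E4 ≃L[ℝ] E4) : E4 →L[ℝ] E4) (E4.basisVector 0))) :=
      ((ContinuousLinearMap.apply ℝ E4 (E4.basisVector 0)).continuous.tendsto _).comp (hΛ j)
    have h2 : Tendsto (fun n ↦ ((((mo n j).1 : E4 ≃L[ℝ] E4) : E4 →L[ℝ] E4) (E4.basisVector 0)) 0) atTop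
        (𝓝 (((((moₗ j).1 : E4 ≃L[ℝ] E4) : E4 →L[ℝ] E4) (E4.basisVector 0)) 0)) :=
      ((PiLp.continuous_apply 2 (fun _ : Fin 4 ↦ ℝ) (0 : Fin 4)).tendsto _).comp h1
    have h3 := h2.inv₀ (rme_lorentz_apply_zero_ne_zero (moₗ j).1)
    have h4 : Tendsto (fun n ↦ E4.spatial ((((mo n j).1 : E4 ≃L[ℝ] E4) : E4 →L[ℝ] E4) (E4.basisVector 0))) atTop
        (𝓝 (E4.spatial ((((moₗ j).1 : E4 ≃L[ℝ] E4) : E4 →L[ℝ] E4) (E4.basisVector 0)))) :=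
      (E4.spatial.continuous.tendsto _).comp h1
    exact h3.smul h4
  /- STEP 1: eventual closeness in `n` -/
  have hE1 : ∀ j, ∀ᶠ n in atTop, ‖(((mo n j).1 : E4 ≃L[ℝ] E4) : E4 →L[ℝ] E4) - (((moₗ j).1 : E4 ≃L[ℝ] E4) : E4 →L[ℝ] E4)‖ ≤ δA := fun j ↦
    eventually_norm_sub_le (hΛ j) hδA
  have hE2 : ∀ j, ∀ᶠ n in atTop, |a n j ^ 2 - aₗ j ^ 2| ≤ μ * min (μ / 8) 1 := fun j ↦ by
    have h := eventually_norm_sub_le ((ha j).pow 2) (δ := μ * min (μ / 8) 1) (by positivity)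
    simpa only [Real.norm_eq_abs] using h
  have hE3 : ∀ j, ∀ᶠ n in atTop, |r₀ n j - rₗ j| ≤ μ / 4 := fun j ↦ by
    have h := eventually_norm_sub_le (hr j) (by positivity : (0 : ℝ) < μ / 4)
    simpa only [Real.norm_eq_abs] using h
  have hE4 : ∀ j, ∀ᶠ n in atTop, ∀ i ≤ k, ∀ x : E4, μ ≤ Kerr.radius (aₗ j) (poincareInv (moₗ j).1 (moₗ j).2 x) → Kerr.radius (aₗ j) (poincareInv (moₗ j).1 (moₗ j).2 x) ≤ Rb + 1 →
      ‖iteratedFDeriv ℝ i (fun z ↦ (ContinuousLinearMap.precomp ℝ (TF n j)).comp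
          ((Kerr.bilin (M n j) (a n j) (TF n j (z - (moₗ j).2))).comp (TF n j))) x -
        iteratedFDeriv ℝ i (boostedKerrBilin (moₗ j).1 (moₗ j).2 (Mₗ j) (aₗ j)) x‖ ≤ ε' / 4 :=
    fun j ↦ hT2c k (fun n ↦ M n j) (fun n ↦ a n j) (fun n ↦ TF n j) (Mₗ j) (aₗ j) (moₗ j).1
      (moₗ j).2 μ (Rb + 1) hμ (hM j) (ha j) (hTFlim j) (hTFκ j) (ε' / 4) (by positivity)
  have hE5 : ∀ j, ∀ᶠ n in atTop, ‖Vf (mo n j) - Vf (moₗ j)‖ ≤ δ' * v₀ / 64 := fun j ↦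
    eventually_norm_sub_le (hVlim j) (by positivity)
  obtain ⟨n₀, hn₀⟩ := (eventually_all.2 fun j ↦ (hE1 j).and ((hE2 j).and ((hE3 j).and
    ((hE4 j).and (hE5 j))))).exists_forall_of_atTop
  refine ⟨n₀, ε₀, hε₀0, fun n hn ↦ ?_⟩
  have hEn := hn₀ n hn
  /- STEP 2: the late time, for the fixed configuration `n` -/
  obtain ⟨T₁, hT₁⟩ := hT2a' N (M n) (a n) (r₀ n) (mo n) (hmarg n)
  obtain ⟨T₂, hT₂⟩ := hC1 N₀ m₀ χ μ v₀ L₀ hm₀ hχ hμ hv₀ N (M n) (a n) (r₀ n) (mo n) (hmarg n)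
    (Rb - 1) hRb1
  set dₗ : Fin N → E3 := fun j ↦ E4.spatial (moₗ j).2 - ((moₗ j).2 0) • Vf (moₗ j) with hdₗ
  set dₙ : Fin N → E3 := fun j ↦ E4.spatial (mo n j).2 - ((mo n j).2 0) • Vf (mo n j) with hdₙ
  obtain ⟨Kd, hKd⟩ : ∃ Kd : ℝ, Kd = ∑ j, ‖dₗ j‖ := ⟨_, rfl⟩
  obtain ⟨Kdn, hKdn⟩ : ∃ Kdn : ℝ, Kdn = ∑ j, ‖dₙ j - dₗ j‖ := ⟨_, rfl⟩
  have hKd0 : 0 ≤ Kd := by rw [hKd]; exact Finset.sum_nonneg fun j _ ↦ norm_nonneg _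
  have hKdn0 : 0 ≤ Kdn := by rw [hKdn]; exact Finset.sum_nonneg fun j _ ↦ norm_nonneg _
  have hdle : ∀ j, ‖dₗ j‖ ≤ Kd := fun j ↦ by
    rw [hKd]
    exact Finset.single_le_sum (f := fun i ↦ ‖dₗ i‖) (fun i _ ↦ norm_nonneg _) (Finset.mem_univ j)
  have hdnle : ∀ j, ‖dₙ j - dₗ j‖ ≤ Kdn := fun j ↦ by
    rw [hKdn]
    exact Finset.single_le_sum (f := fun i ↦ ‖dₙ i - dₗ i‖) (fun i _ ↦ norm_nonneg _)
      (Finset.mem_univ j)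
  have ht₅ : 0 < 32 * (2 * (Rb + m₀⁻¹ + 3) + 1) / v₀ := div_pos (by nlinarith) hv₀
  refine ⟨max (max T₁ T₂) (max (max (4 * Kd / v₀) (64 * Kdn / (δ' * v₀)))
    (32 * (2 * (Rb + m₀⁻¹ + 3) + 1) / v₀)), ?_⟩
  intro τ hτ ε hε hεε₀ hslabN
  obtain ⟨R, U, Φ, hslab⟩ := hslabN
  simp only [max_le_iff] at hτ
  obtain ⟨⟨hτ₁, hτ₂⟩, ⟨hτ₃, hτ₄⟩, hτ₅⟩ := hτ
  have hτ0 : 0 ≤ τ := (ht₅.trans_le hτ₅).le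
  have hτv : 32 * (2 * (Rb + m₀⁻¹ + 3) + 1) ≤ τ * v₀ := (div_le_iff₀ hv₀).1 hτ₅
  have hτ₃' : 4 * Kd ≤ τ * v₀ := (div_le_iff₀ hv₀).1 hτ₃
  have hτ₄' : 64 * Kdn ≤ τ * (δ' * v₀) := (div_le_iff₀ (mul_pos hδ'0 hv₀)).1 hτ₄
  set ϱ : ℝ := τ * v₀ / 32 with hϱ
  have hϱbig : 2 * (Rb + m₀⁻¹ + 3) + 1 ≤ ϱ := by rw [hϱ]; linarith
  have hϱ2 : 2 * (Rb + m₀⁻¹ + 3) ≤ ϱ := by linarith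
  have hϱ1 : 1 ≤ ϱ := by nlinarith
  have hϱ0 : 0 ≤ ϱ := by linarith
  -- lab positions at lab time `τ`: `X = d + τ V`
  have hXdecomp : ∀ q : ↥lorentzGroup × E4, E4.spatial q.2 + (τ - q.2 0) • Vf q =
      (E4.spatial q.2 - (q.2 0) • Vf q) + τ • Vf q := fun q ↦ by rw [sub_smul]; abel
  -- recession separates the limit holes
  have hsep : ∀ i j, i ≠ j → 16 * ϱ ≤ ‖(E4.spatial (moₗ i).2 + (τ - (moₗ i).2 0) • Vf (moₗ i)) -
      (E4.spatial (moₗ j).2 + (τ - (moₗ j).2 0) • Vf (moₗ j))‖ := by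
    intro i j hij
    rw [hXdecomp, hXdecomp]
    have h := sub_le_norm_centre_sub hτ0 (hmargₗ.2.2 i j hij) (add_le_add (hdle i) (hdle j))
    change 16 * ϱ ≤ ‖(dₗ i + τ • Vf (moₗ i)) - (dₗ j + τ • Vf (moₗ j))‖
    rw [hϱ]
    linarith
  -- the lab positions of the two configurations are `δ' ϱ`-close
  have hoff : ∀ j, ‖(E4.spatial (mo n j).2 + (τ - (mo n j).2 0) • Vf (mo n j)) -
      (E4.spatial (moₗ j).2 + (τ - (moₗ j).2 0) • Vf (moₗ j))‖ ≤ δ' * ϱ := by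
    intro j
    rw [hXdecomp, hXdecomp]
    change ‖(dₙ j + τ • Vf (mo n j)) - (dₗ j + τ • Vf (moₗ j))‖ ≤ δ' * ϱ
    have e : (dₙ j + τ • Vf (mo n j)) - (dₗ j + τ • Vf (moₗ j)) =
        (dₙ j - dₗ j) + τ • (Vf (mo n j) - Vf (moₗ j)) := by rw [smul_sub]; abel
    rw [e]
    refine (norm_add_le _ _).trans ?_
    rw [norm_smul, Real.norm_of_nonneg hτ0]
    have h2 : τ * ‖Vf (mo n j) - Vf (moₗ j)‖ ≤ τ * (δ' * v₀ / 64) :=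
      mul_le_mul_of_nonneg_left (hEn j).2.2.2.2 hτ0
    have e1 : τ * (δ' * v₀ / 64) = τ * (δ' * v₀) / 64 := by ring
    have e2 : δ' * ϱ = τ * (δ' * v₀) / 32 := by rw [hϱ]; ring
    rw [e1] at h2
    rw [e2]
    linarith [hdnle j]
  -- the re-anchoring map (A′)
  obtain ⟨Θ, β, hΘs, hΘt, hΘb, hΘe, hΘloc⟩ := hA'all (fun j ↦ (mo n j).1) (fun j ↦ (moₗ j).1)
    (fun j ↦ (mo n j).2) (fun j ↦ (moₗ j).2) τ ϱ hϱ1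
    (fun j ↦ ⟨hΛl j, hΛls j, hΛn n j, (hEn j).1⟩)
    (fun j ↦ (hoff j).trans (mul_le_mul_of_nonneg_right hδ'A hϱ0)) hsep
  /- STEP 3–4: the fixed-time transfer -/
  have hcfg : ∀ i, μ ≤ r₀ n i ∧ r₀ n i + μ / 4 ≤ r₀ₗ i ∧ r₀ n i + 2 ≤ Rb ∧ r₀ₗ i + 2 ≤ Rb ∧
      |a n i| ≤ m₀⁻¹ ∧ |aₗ i| ≤ m₀⁻¹ := fun i ↦ by
    refine ⟨(hmf n i).2.2, ?_, hr₀b n i, hrₗb i, (hmf n i).2.1, (hmfₗ i).2.1⟩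
    have h := abs_le.mp (hEn i).2.2.1
    rw [hr₀ₗ]
    linarith
  have hspin : ∀ i (y : E4), μ ≤ Kerr.radius (aₗ i) y →
      |Kerr.radius (a n i) y - Kerr.radius (aₗ i) y| ≤ min (μ / 8) 1 := fun i y hy ↦ by
    refine (Kerr.abs_radius_sub_radius_le_div_of_le (a n i) (aₗ i) y hμ hy).trans ?_
    rw [div_le_iff₀ hμ]
    linarith [(hEn i).2.1]
  have hnum1 : 4 ^ k * (k.factorial : ℝ) * 2 ^ (k + 2) * ε + ε' / 4 ≤ ε' := by
    rw [← hAk]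
    have h := mul_le_mul_of_nonneg_left hεε₀ hAk0.le
    linarith
  have hnum2 : 4 ^ k * (k.factorial : ℝ) * 2 ^ (k + 2) * f₀ + 2 ^ (k + 2) * ‖Minkowski.bilin‖ * η ≤
      ε' := by
    rw [← hAk, ← hBk, hf₀, mul_add]
    linarith
  have hoff8 : ∀ j, ‖(E4.spatial (mo n j).2 + (τ - (mo n j).2 0) • Vf (mo n j)) -
      (E4.spatial (moₗ j).2 + (τ - (moₗ j).2 0) • Vf (moₗ j))‖ ≤ ϱ / 8 := fun j ↦
    (hoff j).trans (by nlinarith)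
  have hRj : ∀ j, Rb + 3 ≤ R j := hT₁ τ hτ₁ ε hε (hεε₀.trans hε₀b) R U Φ hslab
  have hBn : ∀ z : E4, z 0 = τ → (∀ l, r₀ n l < Kerr.radius (a n l) (poincareInv (mo n l).1 (mo n l).2 z)) → (∀ l, Rb - 1 ≤ Kerr.radius (a n l) (poincareInv (mo n l).1 (mo n l).2 z)) →
      ∀ m ≤ k, ‖iteratedFDeriv ℝ m (𝒟.toSpacetime.deviationExtend (Minkowski.backgroundOn U) Φ) z‖ ≤
        f₀ := fun z hz0 hzr hzR m hm ↦ by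
    refine (hBall N (M n) (a n) (r₀ n) (mo n) (hmarg n) ε τ R U Φ hε.le hslab z hz0 hzr (Rb - 1)
      hρBRb hzR m hm).trans ?_
    rw [hf₀]
    exact add_le_add hεε₀ (div_le_div_of_nonneg_right hCBc hRb1.le)
  exact slabTransferAtTime_expanded k X D 𝒟 N μ m₀⁻¹ (M n) (a n) (r₀ n) (mo n) Mₗ aₗ r₀ₗ moₗ τ ε ε' Rb ϱ
    η (ε' / 4) f₀ Θ β (TF n) (fun j ↦ ((((((mo n j).1 : E4 ≃L[ℝ] E4) (E4.basisVector 0)) 0))⁻¹ • ((E4.dx 0).comp (((moₗ j).1 : E4 ≃L[ℝ] E4) : E4 →L[ℝ] E4) - (E4.dx 0).comp (((mo n j).1 : E4 ≃L[ℝ] E4) : E4 →L[ℝ] E4))))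
    (fun j ↦ E4.spatial (mo n j).2 + (τ - (mo n j).2 0) • Vf (mo n j))
    (fun j ↦ E4.spatial (moₗ j).2 + (τ - (moₗ j).2 0) • Vf (moₗ j)) R U Φ hμ hm₀'.le hRb2 hcfg
    hspin hϱ2 hε hη0.le hη8 hf₀0 hf₀8 hnum1 hnum2 (fun j ↦ rfl) (fun j ↦ rfl) hoff8 (fun j ↦ rfl)
    hΘs hΘt hΘb hΘe hΘloc (hEn · |>.2.2.2.1) hslab hRj hBn
    (fun z hz0 hzR ↦ hT₂ τ hτ₂ R z hz0 hzR)

/-- stub Final — **SLAB TRANSFER TO THE LIMIT CONFIGURATION** (registered stub of crux stmt-FinalStateConjecture-17646, line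
`registered`, rev 10): for a sequence of multi-Kerr configurations in one margin family converging to a limit in the
margins (`r₀ₗ = lim r₀ + μ/2`), hand-over slabs of the `n`-th configuration at small accuracy and late lab time
re-anchor to hand-over slabs of the LIMIT configuration at any prescribed accuracy `ε'` (`SlabAt` / `InMargins` of
`KerrnessPropagatesKerrBasinCaptureDefs`). It is `slabTransferCore3_expanded` fed with the landed pieces of the line
(A' `stub_reanchorMapShear`, P-struct `stub_transferChart`, G `stub_uniformBoostedKerrDecay`, B `stub_farFieldFlatness`,
C1 `stub_flatPathExists`, C2 `stub_orientationTransport`, A `stub_reanchorMapExists`, T2a `stub_largeNearZones`,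
T2b `stub_directionDodging`, T2c `stub_kerrFamilyContinuity`), the named blocks being definitionally the expanded ones. -/
theorem stub_slabTransferFinal : ∀ k : ℕ, ∀ (X : Type) [TopologicalSpace X] [ChartedSpace E3 X] [IsManifold (𝓡 3) (⊤ : ℕ∞) X] [T2Space X] [SecondCountableTopology X] [ConnectedSpace X] (D : InitialDataSet (𝓡 3) X) (𝒟 : VacuumCauchyDevelopment D) (N₀ : ℕ) (m₀ χ μ v₀ L₀ : ℝ), 0 < m₀ → χ < 1 → 0 < μ → 0 < v₀ → ∀ (N : ℕ) (M a r₀ : ℕ → Fin N → ℝ) (mo : ℕ → Fin N → ↥lorentzGroup × E4) (Mₗ aₗ rₗ r₀ₗ : Fin N → ℝ) (moₗ : Fin N → ↥lorentzGroup × E4), (∀ n, InMargins N₀ m₀ χ μ v₀ L₀ N (M n) (a n) (r₀ n) (mo n)) → (∀ i, Tendsto (fun n ↦ M n i) atTop (𝓝 (Mₗ i))) → (∀ i, Tendsto (fun n ↦ a n i) atTop (𝓝 (aₗ i))) → (∀ i, Tendsto (fun n ↦ r₀ n i) atTop (𝓝 (rₗ i))) → (∀ i, Tendsto (fun n ↦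 (((mo n i).1 : E4 ≃L[ℝ] E4) : E4 →L[ℝ] E4)) atTop (𝓝 (((moₗ i).1 : E4 ≃L[ℝ] E4) : E4 →L[ℝ] E4))) → (∀ i, Tendsto (fun n ↦ (((mo n i).1 : E4 ≃L[ℝ] E4).symm : E4 →L[ℝ] E4)) atTop (𝓝 (((moₗ i).1 : E4 ≃L[ℝ] E4).symm : E4 →L[ℝ] E4))) → InMargins N₀ m₀ χ μ v₀ L₀ N Mₗ aₗ rₗ moₗ → (∀ i, r₀ₗ i = rₗ i + μ / 2) → ∀ ε' : ℝ, 0 < ε' → ∃ (n₀ : ℕ) (ε₀ : ℝ), 0 < ε₀ ∧ ∀ n, n₀ ≤ n → ∃ T : ℝ, ∀ τ : ℝ, T ≤ τ → ∀ ε : ℝ, 0 < ε → ε ≤ ε₀ → SlabAt k 𝒟 N (M n) (a n) (r₀ n) (mo n) ε τ → SlabAt k 𝒟 N Mₗ aₗ r₀ₗ moₗ ε' τ :=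
  slabTransferCore3_expanded stub_reanchorMapShear stub_transferChart stub_uniformBoostedKerrDecay
    stub_farFieldFlatness stub_flatPathExists stub_orientationTransport stub_reanchorMapExists
    stub_largeNearZones stub_directionDodging stub_kerrFamilyContinuity

end Summit.FinalStateConjecture.FinalStateConjecture.Theorems.KerrnessPropagates.KerrBasinCapture
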